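import Summits.AtomisticToContinuum.HydrodynamicLimit.Theorems.EnskogAdjointDualityAdjointEnskogTestFamilyRMaxwellianCharacteristic
import Summits.AtomisticToContinuum.HydrodynamicLimit.Theorems.EnskogAdjointDualityAdjointEnskogTestFamilyRTransferBoundLipschitz
import HarnessLib

/-!
# K2R transfer bound V: window constants of the Euler background for the collisional transfer

Route `EnskogAdjointDuality` of `AtomisticToContinuum/HydrodynamicLimit`, crux `AdjointEnskogTestFamilyR`
(stmt-AtomisticToContinuum-11592, "K2R"), line `birth`, stub `stub_transferBound` (G3b), helper V.

For a classical hard-sphere Euler solution `(ρ, u, θ)` on `[0,T)`, a time `t ∈ (0,T)` and the packing guard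
`ρσ³ < η₁` on `[0,t]` (with `f_ex` analytic on `(0, η₁)`), this file produces, ONCE and uniformly in
`s ∈ [0,t]`, every constant entering the `O(ε²)` transfer estimate:

* bounds `0 < ρ ≤ R`, `θm ≤ θ ≤ Θ`, `‖u‖ ≤ U` and a common spatial Lipschitz constant `Lb` of `ρ, θ, u`
  (`k2r_eulerWindow` + `Torus.lipschitzWith_of_norm_partialDeriv_le`);
* a bound `Ȳ` and a Lipschitz constant (in `x`) of the contact factor `Y(σ³ρ) = (3/2π) f_ex'(σ³ρ)` (the
  packing range is a compact sub-interval of `(0, η₁)`, where `f_ex''` is continuous);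
* smoothness of the excess-pressure weight `W₀ = Y(σ³ρ) ρ² θ` and of `W₀ uⱼ`, with one constant bounding
  their gradients and the Lipschitz constants of their gradients (`k2r_tb_exists_gradient_bounds`).

The conjunction is the registered sub-goal `stub_transferBound_window`.

References: C. Cercignani, R. Illner, M. Pulvirenti, *The Mathematical Theory of Dilute Gases* (1994),
§3.3 [CIP1994]; N. F. Carnahan, K. E. Starling, J. Chem. Phys. 51 (1969) 635 (the excess free energy).
-/

noncomputable section

open MeasureTheory Set Filter Topology Function Metric
open scoped InnerProductSpace ContDiff BigOperators NNReal

namespace Summit.AtomisticToContinuum.HydrodynamicLimit.Theorems.EnskogAdjointDuality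

open Literature.Analysis.FluidPDE Literature.MathematicalPhysics.KineticTheory
  Literature.Analysis.FunctionSpaces

/-! ## The contact factor on the packing range -/

/-- **The contact factor is bounded and Lipschitz on a compact packing range.** If `f_ex` is analytic on
`(0, η₁)` and `[a, b] ⊆ (0, η₁)`, then `Y = (3/2π) f_ex'` is bounded on `[a, b]` and Lipschitz there
(`f_ex''` is continuous on the compact interval; mean value inequality). [folklore] -/
theorem k2r_tb_contact_lipschitz {η₁ a b : ℝ} (hA : AnalyticOnNhd ℝ hsExcessFreeEnergy (Ioo 0 η₁))
    (ha : 0 < a) (hb : b < η₁) :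
    ∃ Yb D : ℝ, 0 ≤ Yb ∧ 0 ≤ D ∧
      (∀ η ∈ Icc a b, |3 / (2 * Real.pi) * deriv hsExcessFreeEnergy η| ≤ Yb) ∧
      ∀ η ∈ Icc a b, ∀ η' ∈ Icc a b,
        |3 / (2 * Real.pi) * deriv hsExcessFreeEnergy η - 3 / (2 * Real.pi) * deriv hsExcessFreeEnergy η'| ≤
          D * |η - η'| := by
  set Y : ℝ → ℝ := fun η => 3 / (2 * Real.pi) * deriv hsExcessFreeEnergy η with hY
  have hsub : Icc a b ⊆ Ioo 0 η₁ := fun η hη => ⟨ha.trans_le hη.1, hη.2.trans_lt hb⟩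
  have hA1 : AnalyticOnNhd ℝ (deriv hsExcessFreeEnergy) (Ioo 0 η₁) := hA.deriv
  have hA2 : AnalyticOnNhd ℝ (deriv (deriv hsExcessFreeEnergy)) (Ioo 0 η₁) := hA1.deriv
  have hYc : ContinuousOn Y (Icc a b) := (continuousOn_const.mul hA1.continuousOn).mono hsub
  obtain ⟨Yb, hYb⟩ := isCompact_Icc.exists_bound_of_continuousOn hYc
  have hY'c : ContinuousOn (fun η => 3 / (2 * Real.pi) * deriv (deriv hsExcessFreeEnergy) η) (Icc a b) :=
    (continuousOn_const.mul hA2.continuousOn).mono hsub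
  obtain ⟨D, hD⟩ := isCompact_Icc.exists_bound_of_continuousOn hY'c
  have hderiv : ∀ η ∈ Icc a b, HasDerivAt Y (3 / (2 * Real.pi) * deriv (deriv hsExcessFreeEnergy) η) η :=
    fun η hη => ((hA1 η (hsub hη)).differentiableAt.hasDerivAt).const_mul _
  have hLip : LipschitzOnWith (Real.toNNReal D) Y (Icc a b) := by
    refine (convex_Icc a b).lipschitzOnWith_of_nnnorm_deriv_le (fun η hη => (hderiv η hη).differentiableAt)
      fun η hη => ?_
    rw [(hderiv η hη).deriv, ← NNReal.coe_le_coe, coe_nnnorm]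
    exact (hD η hη).trans (Real.le_coe_toNNReal D)
  refine ⟨|Yb|, Real.toNNReal D, abs_nonneg _, (Real.toNNReal D).2, fun η hη => ?_, fun η hη η' hη' => ?_⟩
  · have h := hYb η hη
    rw [Real.norm_eq_abs] at h
    exact h.trans (le_abs_self _)
  · have h := hLip.dist_le_mul η hη η' hη'
    rwa [Real.dist_eq, Real.dist_eq] at h

/-! ## The window -/

section Euler

variable {η₁ σ T t : ℝ} {ρ θ : ℝ → T3 → ℝ} {u : ℝ → T3 → V3}

/-- **Window constants for the collisional transfer.** For a classical hard-sphere Euler solution on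
`[0,T)`, `t ∈ (0,T)`, `0 < σ ≤ 1` and the packing guard `ρσ³ < η₁` on `[0,t]` (`f_ex` analytic on
`(0,η₁)`): uniformly in `s ∈ [0,t]`, the slices `ρ_s, θ_s, u_s` and the contact factor `Y(σ³ρ_s)` are
continuous, `0 ≤ ρ ≤ R`, `θm ≤ θ ≤ Θ` (`θm > 0`), `‖u‖ ≤ U`, `|Y(σ³ρ)| ≤ Ȳ`, all four are Lipschitz in `x`
with constants `Lb`, `LY`, the weights `W₀ = Y(σ³ρ)ρ²θ` and `W₀uⱼ` are smooth in `x`, and one constant `K`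
bounds their gradients and the Lipschitz constants of their gradients. [cite: CIP1994, §3.3] -/
theorem k2r_tb_window (hA : AnalyticOnNhd ℝ hsExcessFreeEnergy (Ioo 0 η₁)) (hσ : 0 < σ) (hσ1 : σ ≤ 1)
    (hEul : IsHardSphereEulerSolution σ T ρ u θ) (ht : t ∈ Ioo 0 T)
    (hguard : ∀ s ∈ Icc 0 t, ∀ x, ρ s x * σ ^ 3 < η₁) :
    ∃ R U θm Θ Lb Yb LY K : ℝ, 0 < θm ∧ 0 ≤ Lb ∧ 0 ≤ LY ∧ 0 ≤ K ∧
      (∀ s ∈ Icc 0 t, Continuous (ρ s) ∧ Continuous (θ s) ∧ Continuous (u s) ∧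
        Continuous (fun x => 3 / (2 * Real.pi) * deriv hsExcessFreeEnergy (σ ^ 3 * ρ s x))) ∧
      (∀ s ∈ Icc 0 t, ∀ x, (0 ≤ ρ s x ∧ ρ s x ≤ R) ∧ (θm ≤ θ s x ∧ θ s x ≤ Θ) ∧ ‖u s x‖ ≤ U ∧
        |3 / (2 * Real.pi) * deriv hsExcessFreeEnergy (σ ^ 3 * ρ s x)| ≤ Yb) ∧
      (∀ s ∈ Icc 0 t, ∀ x x', |ρ s x - ρ s x'| ≤ Lb * dist x x' ∧ |θ s x - θ s x'| ≤ Lb * dist x x' ∧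
        ‖u s x - u s x'‖ ≤ Lb * dist x x' ∧
        |3 / (2 * Real.pi) * deriv hsExcessFreeEnergy (σ ^ 3 * ρ s x) -
          3 / (2 * Real.pi) * deriv hsExcessFreeEnergy (σ ^ 3 * ρ s x')| ≤ LY * dist x x') ∧
      (∀ s ∈ Icc 0 t,
        Torus.IsSmooth (fun x => 3 / (2 * Real.pi) * deriv hsExcessFreeEnergy (σ ^ 3 * ρ s x) *
          ρ s x ^ 2 * θ s x) ∧
        ∀ j : Fin 3, Torus.IsSmooth (fun y => 3 / (2 * Real.pi) * deriv hsExcessFreeEnergy (σ ^ 3 * ρ s y) *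
          ρ s y ^ 2 * θ s y * u s y j)) ∧
      (∀ s ∈ Icc 0 t, ∀ x,
        ‖Torus.gradient (fun x => 3 / (2 * Real.pi) * deriv hsExcessFreeEnergy (σ ^ 3 * ρ s x) *
          ρ s x ^ 2 * θ s x) x‖ ≤ K ∧
        ∀ j : Fin 3, ‖Torus.gradient (fun y => 3 / (2 * Real.pi) * deriv hsExcessFreeEnergy (σ ^ 3 * ρ s y) *
          ρ s y ^ 2 * θ s y * u s y j) x‖ ≤ K) ∧
      (∀ s ∈ Icc 0 t, ∀ x x',
        ‖Torus.gradient (fun x => 3 / (2 * Real.pi) * deriv hsExcessFreeEnergy (σ ^ 3 * ρ s x) *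
            ρ s x ^ 2 * θ s x) x -
          Torus.gradient (fun x => 3 / (2 * Real.pi) * deriv hsExcessFreeEnergy (σ ^ 3 * ρ s x) *
            ρ s x ^ 2 * θ s x) x'‖ ≤ K * dist x x' ∧
        ∀ j : Fin 3, ‖Torus.gradient (fun y => 3 / (2 * Real.pi) * deriv hsExcessFreeEnergy (σ ^ 3 * ρ s y) *
            ρ s y ^ 2 * θ s y * u s y j) x -
          Torus.gradient (fun y => 3 / (2 * Real.pi) * deriv hsExcessFreeEnergy (σ ^ 3 * ρ s y) *
            ρ s y ^ 2 * θ s y * u s y j) x'‖ ≤ K * dist x x') := by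
  set Y : ℝ → ℝ := fun η => 3 / (2 * Real.pi) * deriv hsExcessFreeEnergy η with hY
  have ht0 : 0 < t := ht.1
  have htT : t < T := ht.2
  have hsub : Icc 0 t ⊆ Ico 0 T := fun s hs => ⟨hs.1, hs.2.trans_lt htT⟩
  obtain ⟨R, U, θm, Θ, B, hθm, hB0, hR, hU, hΘ, -, hDx, -⟩ := k2r_eulerWindow hEul ht0.le htT
  obtain ⟨hρc, -, -, -⟩ := eulerProfiles_window hEul htT
  -- (1) spatial Lipschitz constant of the fields
  set M : Fin 3 → ℝ≥0 := fun _ => ⟨B, hB0⟩ with hM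
  set LbN : ℝ≥0 := NNReal.sqrt (Fintype.card (Fin 3)) * ∑ i, M i with hLbN
  have hLipρ : ∀ s ∈ Icc 0 t, ∀ x x', |ρ s x - ρ s x'| ≤ (LbN : ℝ) * dist x x' := by
    intro s hs x x'
    have h1 : Torus.IsContDiff 1 (ρ s) := (hEul.smooth_density.isSmooth_slice (hsub hs)).isContDiff (by simp)
    have h := (Torus.lipschitzWith_of_norm_partialDeriv_le h1 (M := M) fun i y => by
      rw [Real.norm_eq_abs]; exact (hDx s hs y i).1).dist_le_mul x x'
    rwa [Real.dist_eq] at h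
  have hLipθ : ∀ s ∈ Icc 0 t, ∀ x x', |θ s x - θ s x'| ≤ (LbN : ℝ) * dist x x' := by
    intro s hs x x'
    have h1 : Torus.IsContDiff 1 (θ s) :=
      (hEul.smooth_temperature.isSmooth_slice (hsub hs)).isContDiff (by simp)
    have h := (Torus.lipschitzWith_of_norm_partialDeriv_le h1 (M := M) fun i y => by
      rw [Real.norm_eq_abs]; exact (hDx s hs y i).2.1).dist_le_mul x x'
    rwa [Real.dist_eq] at h
  have hLipu : ∀ s ∈ Icc 0 t, ∀ x x', ‖u s x - u s x'‖ ≤ (LbN : ℝ) * dist x x' := by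
    intro s hs x x'
    have h1 : Torus.IsContDiff 1 (u s) := (hEul.smooth_velocity.isSmooth_slice (hsub hs)).isContDiff (by simp)
    have h := (Torus.lipschitzWith_of_norm_partialDeriv_le h1 (M := M) fun i y =>
      (hDx s hs y i).2.2).dist_le_mul x x'
    rwa [dist_eq_norm] at h
  -- (2) the packing range `[σ³ρm, σ³ρM] ⊆ (0, η₁)` and the contact factor there
  obtain ⟨ρm, hρm, hρm'⟩ := k2r_exists_pos_le_window ht0.le hρc fun s hs x => (hR s hs x).1
  have hKc : IsCompact (Icc 0 t ×ˢ (univ : Set T3)) := isCompact_Icc.prod isCompact_univ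
  obtain ⟨pM, hpM, hmax⟩ := hKc.exists_isMaxOn ⟨(0, 0), ⟨left_mem_Icc.2 ht0.le, mem_univ _⟩⟩ hρc
  set a : ℝ := σ ^ 3 * ρm with ha
  set b : ℝ := σ ^ 3 * ρ pM.1 pM.2 with hb
  have hσ3 : 0 < σ ^ 3 := pow_pos hσ 3
  have hσ31 : σ ^ 3 ≤ 1 := pow_le_one₀ hσ.le hσ1
  have ha0 : 0 < a := mul_pos hσ3 hρm
  have hb1 : b < η₁ := by rw [hb, mul_comm]; exact hguard pM.1 hpM.1 pM.2
  have hrange : ∀ s ∈ Icc 0 t, ∀ x, σ ^ 3 * ρ s x ∈ Icc a b := fun s hs x =>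
    ⟨mul_le_mul_of_nonneg_left (hρm' s hs x) hσ3.le,
      mul_le_mul_of_nonneg_left (hmax (show (s, x) ∈ Icc 0 t ×ˢ univ from ⟨hs, mem_univ _⟩)) hσ3.le⟩
  have hIoo : ∀ s ∈ Icc 0 t, ∀ x, σ ^ 3 * ρ s x ∈ Ioo 0 η₁ := fun s hs x =>
    ⟨ha0.trans_le (hrange s hs x).1, (hrange s hs x).2.trans_lt hb1⟩
  obtain ⟨Yb, D, hYb0, hD0, hYb, hYD⟩ := k2r_tb_contact_lipschitz hA ha0 hb1
  -- (3) smoothness of the weights as space–time fields on `[0, t]`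
  have hρst : Torus.IsSmoothSpaceTimeOn (Icc 0 t) ρ := hEul.smooth_density.mono hsub
  have hθst : Torus.IsSmoothSpaceTimeOn (Icc 0 t) θ := hEul.smooth_temperature.mono hsub
  have hust : Torus.IsSmoothSpaceTimeOn (Icc 0 t) u := hEul.smooth_velocity.mono hsub
  have hYsm : ContDiffOn ℝ ∞ Y (Ioo 0 η₁) := contDiffOn_const.mul hA.deriv.contDiffOn_of_completeSpace
  have hYst : Torus.IsSmoothSpaceTimeOn (Icc 0 t) (fun s x => Y (σ ^ 3 * ρ s x)) :=
    k2r_tb_isSmoothSpaceTimeOn_comp (ρ := fun s x => σ ^ 3 * ρ s x)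
      ((Torus.isSmoothSpaceTimeOn_const (Torus.isSmooth_const (σ ^ 3)) _).mul hρst) hYsm hIoo
  have hWst : Torus.IsSmoothSpaceTimeOn (Icc 0 t) (fun s x => Y (σ ^ 3 * ρ s x) * ρ s x ^ 2 * θ s x) := by
    have h : Torus.IsSmoothSpaceTimeOn (Icc 0 t) (fun s x => Y (σ ^ 3 * ρ s x) * (ρ s x * ρ s x) * θ s x) :=
      ((hYst.mul (hρst.mul hρst)).mul hθst)
    have he : (fun s x => Y (σ ^ 3 * ρ s x) * ρ s x ^ 2 * θ s x) =
        fun s x => Y (σ ^ 3 * ρ s x) * (ρ s x * ρ s x) * θ s x := by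
      funext s x; ring
    rw [he]; exact h
  have hWjst : ∀ j : Fin 3, Torus.IsSmoothSpaceTimeOn (Icc 0 t)
      (fun s y => Y (σ ^ 3 * ρ s y) * ρ s y ^ 2 * θ s y * u s y j) := fun j => hWst.mul (hust.apply j)
  obtain ⟨K₀, hK₀0, hWsm, -, hG₀, -, hGL₀⟩ := k2r_tb_exists_gradient_bounds ht0 hWst
  have hKj : ∀ j : Fin 3, ∃ Kj : ℝ, 0 ≤ Kj ∧
      (∀ s ∈ Icc 0 t, Torus.IsSmooth (fun y => Y (σ ^ 3 * ρ s y) * ρ s y ^ 2 * θ s y * u s y j)) ∧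
      (∀ s ∈ Icc 0 t, ∀ x, ‖Torus.gradient (fun y => Y (σ ^ 3 * ρ s y) * ρ s y ^ 2 * θ s y * u s y j) x‖
        ≤ Kj) ∧
      (∀ s ∈ Icc 0 t, ∀ x x', ‖Torus.gradient (fun y => Y (σ ^ 3 * ρ s y) * ρ s y ^ 2 * θ s y * u s y j) x -
        Torus.gradient (fun y => Y (σ ^ 3 * ρ s y) * ρ s y ^ 2 * θ s y * u s y j) x'‖ ≤ Kj * dist x x') := by
    intro j
    obtain ⟨Kj, hKj0, hsm, -, hG, -, hGL⟩ := k2r_tb_exists_gradient_bounds ht0 (hWjst j)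
    exact ⟨Kj, hKj0, hsm, hG, hGL⟩
  choose Kj hKj0 hWjsm hGj hGLj using hKj
  set K : ℝ := K₀ + ∑ j, Kj j with hK
  have hKsum : 0 ≤ ∑ j, Kj j := Finset.sum_nonneg fun j _ => hKj0 j
  have hK₀le : K₀ ≤ K := le_add_of_nonneg_right hKsum
  have hKjle : ∀ j, Kj j ≤ K := fun j =>
    (Finset.single_le_sum (fun i _ => hKj0 i) (Finset.mem_univ j)).trans (le_add_of_nonneg_left hK₀0)
  -- (4) assembly
  refine ⟨R, U, θm, Θ, LbN, Yb, D * LbN, K, hθm, LbN.2, mul_nonneg hD0 LbN.2, by positivity,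
    fun s hs => ⟨?_, ?_, ?_, ?_⟩, fun s hs x => ⟨⟨(hR s hs x).1.le, (hR s hs x).2⟩, hΘ s hs x, hU s hs x,
      hYb _ (hrange s hs x)⟩,
    fun s hs x x' => ⟨hLipρ s hs x x', hLipθ s hs x x', hLipu s hs x x', ?_⟩,
    fun s hs => ⟨hWsm s hs, fun j => hWjsm j s hs⟩,
    fun s hs x => ⟨(hG₀ s hs x).trans hK₀le, fun j => (hGj j s hs x).trans (hKjle j)⟩,
    fun s hs x x' => ⟨(hGL₀ s hs x x').trans (mul_le_mul_of_nonneg_right hK₀le dist_nonneg),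
      fun j => (hGLj j s hs x x').trans (mul_le_mul_of_nonneg_right (hKjle j) dist_nonneg)⟩⟩
  · exact (hEul.smooth_density.isSmooth_slice (hsub hs)).continuous
  · exact (hEul.smooth_temperature.isSmooth_slice (hsub hs)).continuous
  · exact (hEul.smooth_velocity.isSmooth_slice (hsub hs)).continuous
  · exact (hYst.isSmooth_slice hs).continuous
  · calc |Y (σ ^ 3 * ρ s x) - Y (σ ^ 3 * ρ s x')| ≤ D * |σ ^ 3 * ρ s x - σ ^ 3 * ρ s x'| :=
          hYD _ (hrange s hs x) _ (hrange s hs x')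
      _ = D * (σ ^ 3 * |ρ s x - ρ s x'|) := by rw [← mul_sub, abs_mul, abs_of_pos hσ3]
      _ ≤ D * (1 * ((LbN : ℝ) * dist x x')) := by
          refine mul_le_mul_of_nonneg_left (mul_le_mul hσ31 (hLipρ s hs x x') (abs_nonneg _) zero_le_one) hD0
      _ = D * LbN * dist x x' := by ring

/-- **Registered sub-goal `stub_transferBound_window`** (K2R line `birth`, stub G3b, helper V): the window
constants of the Euler background for the collisional transfer (`k2r_tb_window`), as a closed statement in
the crux's `let`-vocabulary (`Y`, `W₀`). [cite: CIP1994, §3.3] -/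
theorem stub_transferBound_window :
    ∀ (η₁ : ℝ), AnalyticOnNhd ℝ Literature.MathematicalPhysics.KineticTheory.hsExcessFreeEnergy (Set.Ioo 0 η₁) →
    ∀ (σ T : ℝ), 0 < σ → σ ≤ 1 → ∀ (ρ θ : ℝ → UnitAddTorus (Fin 3) → ℝ)
      (u : ℝ → UnitAddTorus (Fin 3) → EuclideanSpace ℝ (Fin 3)),
    Literature.MathematicalPhysics.KineticTheory.IsHardSphereEulerSolution σ T ρ u θ →
    ∀ t ∈ Set.Ioo 0 T, (∀ s ∈ Set.Icc 0 t, ∀ x, ρ s x * σ ^ 3 < η₁) →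
    (let Y := fun η : ℝ => 3 / (2 * Real.pi) * deriv Literature.MathematicalPhysics.KineticTheory.hsExcessFreeEnergy η
     let W₀ := fun (s : ℝ) (x : UnitAddTorus (Fin 3)) => Y (σ ^ 3 * ρ s x) * ρ s x ^ 2 * θ s x
     ∃ R U θm Θ Lb Yb LY K : ℝ, 0 < θm ∧ 0 ≤ Lb ∧ 0 ≤ LY ∧ 0 ≤ K ∧
      (∀ s ∈ Set.Icc 0 t, Continuous (ρ s) ∧ Continuous (θ s) ∧ Continuous (u s) ∧
        Continuous (fun x => Y (σ ^ 3 * ρ s x))) ∧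
      (∀ s ∈ Set.Icc 0 t, ∀ x, (0 ≤ ρ s x ∧ ρ s x ≤ R) ∧ (θm ≤ θ s x ∧ θ s x ≤ Θ) ∧ ‖u s x‖ ≤ U ∧
        |Y (σ ^ 3 * ρ s x)| ≤ Yb) ∧
      (∀ s ∈ Set.Icc 0 t, ∀ x x', |ρ s x - ρ s x'| ≤ Lb * dist x x' ∧ |θ s x - θ s x'| ≤ Lb * dist x x' ∧
        ‖u s x - u s x'‖ ≤ Lb * dist x x' ∧ |Y (σ ^ 3 * ρ s x) - Y (σ ^ 3 * ρ s x')| ≤ LY * dist x x') ∧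
      (∀ s ∈ Set.Icc 0 t, Literature.Analysis.FunctionSpaces.Torus.IsSmooth (W₀ s) ∧
        ∀ j : Fin 3, Literature.Analysis.FunctionSpaces.Torus.IsSmooth (fun y => W₀ s y * u s y j)) ∧
      (∀ s ∈ Set.Icc 0 t, ∀ x, ‖Literature.Analysis.FunctionSpaces.Torus.gradient (W₀ s) x‖ ≤ K ∧
        ∀ j : Fin 3, ‖Literature.Analysis.FunctionSpaces.Torus.gradient (fun y => W₀ s y * u s y j) x‖ ≤ K) ∧
      (∀ s ∈ Set.Icc 0 t, ∀ x x',
        ‖Literature.Analysis.FunctionSpaces.Torus.gradient (W₀ s) x -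
          Literature.Analysis.FunctionSpaces.Torus.gradient (W₀ s) x'‖ ≤ K * dist x x' ∧
        ∀ j : Fin 3, ‖Literature.Analysis.FunctionSpaces.Torus.gradient (fun y => W₀ s y * u s y j) x -
          Literature.Analysis.FunctionSpaces.Torus.gradient (fun y => W₀ s y * u s y j) x'‖ ≤ K * dist x x')) :=
  fun _ hA _ _ hσ hσ1 _ _ _ hEul _ ht hguard => k2r_tb_window hA hσ hσ1 hEul ht hguard

end Euler

end Summit.AtomisticToContinuum.HydrodynamicLimit.Theorems.EnskogAdjointDuality

end
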